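/-
COR-CM (cell pub-hodgecm2, stage 2 of the Hodge ladder) — Δ2 BRIDGE, item (c) J-RECORD PIN: THE (c) FIELDS OF THE SOCKET BY VALUE.
Seat prover-pub-hodgecm2-d2bridge-prove-5-g1-0 (successor of prove-5 g0, the J2 «Albanese on components» lineage), 2026-08-23.
New file, OUTSIDE the frozen port manifest.  Four definitions + theorems; explicit per-declaration binders; no instance, no named fact, no
`sorry`.  FRAMING: HC_CM is NOT proved; «Δ2 BRIDGE CLOSED» is NOT claimed; nothing here is a display or a pointer move.
-/
import Summits.HodgeConjecture.CorCM.D2Bridge.ComponentAlbanesePinLaw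
import Summits.HodgeConjecture.CorCM.D2Bridge.Map43RecordAtPin
import Summits.HodgeConjecture.CorCM.D2Bridge.PicardCodeRelabel
import Summits.HodgeConjecture.CorCM.PortJoin.HMDischargeLocal
import Summits.HodgeConjecture.CorCM.D2Bridge.PinSignatures
import Summits.HodgeConjecture.CorCM.B01.Transposition.Item6UniformOmegaRep
import Summits.HodgeConjecture.CorCM.D2Bridge.OmegaAtDeltaPrime
import Literature.NumberTheory.GelbartRogawski1991.UnitaryDualPairThetaKernelCMKTypeFin
import Literature.NumberTheory.Automorphic.Liu2021.AppendixC.Prop413DataOfRestOne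
import Literature.NumberTheory.Automorphic.Liu2021.AppendixC.UniformOmegaCiteLegs
import Literature.NumberTheory.Automorphic.Liu2021.Def45RMuFormSupply
import Literature.AlgebraicGeometry.ComplexMultiplication.CMAbelianVarietyRealisedHolds
import HarnessLib

set_option autoImplicit false

/-!
# Δ2 bridge, J-record pin (c): the socket's `M ∕ jH ∕ hjHinj ∕ hjH` BY VALUE at the socket's literal types

[Liu2021] Y. Liu, *Fourier–Jacobi cycles and arithmetic relative trace formula*, Camb. J. Math. **9** (2021) = arXiv:2102.11518
(`l. NNNN` = lines of the author's TeX `FJcycle.tex`).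

The (c)+(d) SOCKET of tonight's END (`CorCM/D2Bridge/SocketCD.lean`, = `PortJoin/ClosedPrinted.lean` §A binders :161–:190) asks, per
index line `i : I V (repAt a₀) (muLiu ι₁ rep)` and every conjugate-symplectic weight-one `μ`, at the rest of record
`R := (uniformOmegaRep … (2 * imagUnit F)⁻¹ …).rest (restTailOne (AlgHom.id ℚ F) ι₁ hμ hw …)` — the SHARED `ι₁`-PRESENTED one-object tail on
which the Ω-slot, `hLiu'` and F4's `ω ≠ 0` also live — for

* (c) `M : (toThm418Data C R).Map43RationalData`, `jH : M.HB →ₗ[ℂ] (liuDictionaryPin …).H`, `hjHinj`, `hjH`  ([Liu2021] map (4.3) ∕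
  Rem. 4.17: a rational form of `H` with its `U(V)(𝔸_F^∞)`-action, built in the proof of Thm. 4.18, l. 2247–2253);
* (d) `pieces` (the Albanese-on-pieces package `HcmPieces` below `Level.capThree C.S.K₀`).

THIS FILE inhabits the four (c) fields BY VALUE, as tree terms, at EXACTLY those types:

* `socketJ` — the J2 interface of record (prove-5 g0 ✔ `componentAlbanesePinTotal`, [Liu2021] Lem. 2.4 (1), §4.2, Prop. C.5) at the
  `_holds` rows, typed over the END's App-C datum `sec42DataOf h isoOf ⟨F.K⟩ ι₁ ⟨V.Hm, …⟩ Φ` and the END's Hecke translates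
  `heckeTranslatesFamilyOf heckeTranslate_definedOver_holds h isoOf … h6` (definitionally prove-5's carrier: `pkgF ∕ pkgV` are
  abbreviations and `heckeTranslatesFamilyOf … h6` unfolds to `sec42DataOf_heckeTranslates … h4`), for an ambient `Algebra F ℂ` through
  `ῑ₁` (`hι : algebraMap ∘ c = ι₁`, the instance under which the tree's cofan `X_K ⊗ ℂ = ⊔ P_Γ` lives, ASSEMBLER DECISION #13);
* `socketDμ` — the chosen one object `D_μ ∈ 𝒜(μ)` of the `ι₁`-presented tail ([Liu2021] Def. 4.5 (2), Prop. 4.6 (1)) from the ONE cite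
  `h21` = [Shimura1998, Thm. 21.4] (✔ `Def45.nonempty_cmDatum_polDR_rMuForm_of_casselman`); `h21` is displayed by the END's §B already;
* `socketM` — the (4.3) record `map43RecordAtPin J (AlgHom.id ℚ F) ι₁ … (𝕌 i)-carriers … Dμ τ' hτ'` (prove-2 ✔ `Map43RecordAtPin[Levels]`,
  spelled by its BODY per prove-3's spelling rule) under `letI := ῑ₁.toAlgebra`, `τ' ∈ Φ_μ` ANY member (a CM type is non-empty — the
  (c) families of the socket carry no `PhiMu` guard);
* `socketJH` (`= jHPin … = id` into the tower `= (liuDictionaryPin …).H`, `rfl`), `socketJH_injective`, `socketJH_comm`;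
* `exists_socketC` — the four (c) families in the socket's binder shape (key `hΦμ` carried, unused) are JOINTLY INHABITED.

ORIENTATION.  The four (c) types read neither the dictionary's guard `PhiMu` nor its admissibility `adm` nor `cmClasses` — only `(𝔇).H`,
which is the tower — so the SAME four terms serve the literal key (`liuDictionaryPin`, editions 1∕2) and the re-keyed pin
(`Rekey.liuDictionaryPin`, `.H` equal by `rfl`).  The record needs NO `hinst : algebraMap = ι₁`: it lives at (instance `ῑ₁`, tail `ι₁`), wb-3's
variant V-b.  The fifth field `pieces` is the orientation-sensitive one and is NOT inhabited here: at the literal key its S1 input is refuted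
under the `ῑ₁` instance (✔ `HcmS1WallCertificateConj`), at the re-keyed pin it is wb-3's V-b composition over the same `socketJ ∕ socketDμ`.
HC_CM is NOT proved; «Δ2 BRIDGE CLOSED» is NOT claimed; the residual `pieces` stays displayed wherever an END displays it.

## References
* [Liu2021] Thm. 4.18 (l. 2232–2245) and its proof, map (4.2)∕(4.3) (l. 2247–2253); Rem. 4.17 (l. 2226–2228); Def. 4.5 (2) (l. 1944–1951);
  Prop. 4.6 (1) (l. 1969); Def. 4.11; Def. 4.16 (l. 2219); Lem. 2.4 (1) (l. 1210–1228); §4.2 (l. 2062–2081); App. C Prop. C.5 (l. 4627–4628).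
* [Shimura1998] G. Shimura, *Abelian Varieties with Complex Multiplication and Modular Functions*, §21.4 Thm. 21.4.
* Tree: `CorCM/D2Bridge/{ComponentAlbanesePinLaw, ComponentAlbanesePin, ShimuraComponentInj, Map43RecordAtPin, Map43RecordAtPinLevels,
  Map43RecordAtUniformRest, PicardCodeRelabel, SocketCD, PinSignatures}.lean`, `CorCM/PortJoin/ClosedPrinted.lean` §A,
  `CorCM/B01/Transposition/{Item6UniformOmegaRep, HComp/HeckeTranslatesOfSec42DataOf}.lean`, `Liu2021/Def45RMuFormSupply.lean`.
-/

noncomputable section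

open scoped TensorProduct Matrix

namespace Summit.HodgeConjecture.CorCM.D2Bridge

open NumberField NumberField.InfinitePlace
open HodgeCM.Model HodgeCM.Model.LiuIndex HodgeCM.Model.TowerCarrier
open Summit.HodgeConjecture.CorCM.Model
open Literature.AlgebraicGeometry.Motives (CMType)
open Literature.AlgebraicGeometry.HodgeTheory Literature.NumberTheory.Automorphic.PicardCM
open Literature.AlgebraicGeometry.ShimuraVarieties.UnitaryCanonicalModel
open Literature.NumberTheory.ComplexMultiplication
open Literature.NumberTheory.Automorphic
open Literature.NumberTheory.Automorphic.Liu2021 Literature.NumberTheory.Automorphic.Liu2021.AppendixC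
open Literature.NumberTheory.Automorphic.Liu2021.AppendixC.RestOne
open Literature.NumberTheory.Automorphic.Liu2021.Def411WeilCarriers (lineOf locF Rep)
open Summit.HodgeConjecture.CorCM.Transposition.OmegaTransport (realUnit)
open HodgeCM.Model.ArchSideTerm (e₁)
open Literature.NumberTheory.GelbartRogawski1991 Literature.NumberTheory.GelbartRogawski1991.UnitaryDualPair
open Literature.RepresentationTheory Literature.RepresentationTheory.Liu2021
open Summit.HodgeConjecture.CorCM.Transposition

/-! ### Notation (local, no declarations; VERBATIM `SocketCD.lean` ∕ `ClosedPrinted.lean`) -/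

set_option quotPrecheck false

/-- the PINNED DICTIONARY OF RECORD at `(V, ι₁, a₀)` over the five `_holds` rows. -/
local notation "𝔇⟦" V "," ι₁ "," a₀ "⟧" =>
  liuDictionaryPin exists_isReal_hodgeModel_holds hodgePQ_independent_of_hodgeModel_holds BallQuotient.ballQuotientUniformised_holds
    (cmAbelianVarietyRealised_of_eigenbasis exists_isReal_hodgeModel_holds hodgePQ_independent_of_hodgeModel_holds
      cmAbelianVarietyEigenbasisRealised_holds)
    Literature.NumberTheory.Transcendental.arapura2012_cor_15_4_6_holds V (I V (repAt a₀) (muLiu ι₁ GramClass.rep))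
    (line V (repAt a₀) (muLiu ι₁ GramClass.rep))

/-- the App-C standing datum of record `sec42DataOf h isoOf F ι₁ V Φ`. -/
local notation "ℭ⟦" h "," F "," ι₁ "," V "," Φ "⟧" =>
  sec42DataOf h isoOf ⟨HodgeCM.CMField.K F⟩ ι₁
    ⟨HodgeCM.HermSpace3.Hm V, HodgeCM.HermSpace3.isHermitian V, HodgeCM.HermSpace3.signature_ι₁ V, HodgeCM.HermSpace3.posDef_of_ne V⟩ Φ

/-- the END's Hecke translates of record on `ℭ` (`heckeTranslatesFamilyOf … h6`). -/
local notation "𝒯⟦" h "," h6 "," F "," ι₁ "," V "," Φ "⟧" =>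
  heckeTranslatesFamilyOf heckeTranslate_definedOver_holds h isoOf ⟨HodgeCM.CMField.K F⟩ ι₁
    ⟨HodgeCM.HermSpace3.Hm V, HodgeCM.HermSpace3.isHermitian V, HodgeCM.HermSpace3.signature_ι₁ V, HodgeCM.HermSpace3.posDef_of_ne V⟩ Φ h6

/-- the CARRIERS of the ι₁-presented tail at `μ` ([Liu21, Def. 4.5 (2)]). -/
local notation "𝔠⟦" ι₁ "," μ "," hμ "⟧" => Def45.Carriers.ofPolDR μ (Def45.PolDR ι₁ hμ (Def45.RMuForm ι₁ hμ))

/-- the TAIL OF THE REST OF RECORD at `μ`. -/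
local notation "𝔱⟦" h "," h6 "," F "," ι₁ "," V "," Φ "," μ "," hμ "," hw "⟧" =>
  restTailOne (AlgHom.id ℚ _) ι₁ hμ hw (Def45.Carriers.ofPolDR μ (Def45.PolDR ι₁ hμ (Def45.RMuForm ι₁ hμ)))
    ((heckeTranslatesFamilyOf heckeTranslate_definedOver_holds h isoOf ⟨HodgeCM.CMField.K F⟩ ι₁
      ⟨HodgeCM.HermSpace3.Hm V, HodgeCM.HermSpace3.isHermitian V, HodgeCM.HermSpace3.signature_ι₁ V, HodgeCM.HermSpace3.posDef_of_ne V⟩ Φ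
      h6).rhoΩOne (AlgHom.id ℚ _) ι₁ hμ hw (Def45.Carriers.ofPolDR μ (Def45.PolDR ι₁ hμ (Def45.RMuForm ι₁ hμ))))

/-- the INDEX OF RECORD and its lines. -/
local notation "𝕀⟦" V "," ι₁ "," a₀ "⟧" => I V (repAt a₀) (muLiu ι₁ GramClass.rep)
local notation "𝕃⟦" V "," ι₁ "," a₀ "⟧" => line V (repAt a₀) (muLiu ι₁ GramClass.rep)

/-- the representative section of record at the index line `i`. -/
local notation "𝕣⟦" F "," a₀ "," i "⟧" =>
  Rep.update ↥(maximalRealSubfield (HodgeCM.CMField.K F)) (imagUnitSq (HodgeCM.CMField.K F))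
    (Rep.ofLineOf ↥(maximalRealSubfield (HodgeCM.CMField.K F)) (imagUnitSq (HodgeCM.CMField.K F)))
    (locF ↥(maximalRealSubfield (HodgeCM.CMField.K F)) (imagUnitSq (HodgeCM.CMField.K F))
      (realUnit ⟨HodgeCM.CMField.K F⟩ (repAt a₀ (Sigma.fst i)).1 (repAt a₀ (Sigma.fst i)).2.1 (repAt a₀ (Sigma.fst i)).2.2))
    (realUnit ⟨HodgeCM.CMField.K F⟩ (repAt a₀ (Sigma.fst i)).1 (repAt a₀ (Sigma.fst i)).2.1 (repAt a₀ (Sigma.fst i)).2.2) rfl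

/-- the μ-UNIFORM WEIL CARRIERS OF RECORD at the index line `i`. -/
local notation "𝕌⟦" h "," F "," ι₁ "," V "," Φ "," a₀ "," i "⟧" =>
  uniformOmegaRep h ⟨HodgeCM.CMField.K F⟩ ι₁
    ⟨HodgeCM.HermSpace3.Hm V, HodgeCM.HermSpace3.isHermitian V, HodgeCM.HermSpace3.signature_ι₁ V, HodgeCM.HermSpace3.posDef_of_ne V⟩ Φ
    e₁ (frameD V) (frameD_real V) (frameD_ne V) (ιVE V) (2 * imagUnit (HodgeCM.CMField.K F))⁻¹ (fun _ _ => 𝕣⟦F, a₀, i⟧)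


/-! ## §1  The inputs of record: the J2 interface at the END's carrier, the one object, a member of `Φ_μ` -/

/-- **The J2 interface of record** ([Liu2021] Lem. 2.4 (1), §4.2, App. C Prop. C.5: the component Albanese morphisms of the tower's
pieces with their laws): prove-5's `componentAlbanesePinTotal` at the `_holds` rows, typed over the END's `sec42DataOf …` and
`heckeTranslatesFamilyOf … h6` (the same carrier up to the abbreviations `pkgF ∕ pkgV` and the unfolding of `heckeTranslatesFamilyOf`), for any
ambient `Algebra F ℂ` through `ῑ₁`. [cite: Liu2021, proof of Lemma 2.4 (1) (FJcycle.tex l. 1220–1228); §4.2 l. 2062–2074; Prop. C.5 (l. 4627–4628)] -/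
def socketJ (F : HodgeCM.CMField) [IsGalois ℚ (F : Type)] (h6 : 6 ≤ Module.finrank ℚ (F : Type))
    {ι₁ : (F : Type) →+* ℂ} (V : HodgeCM.HermSpace3 F ι₁) (h : exists_recordSystem) (Φ : CMType (F : Type))
    [Algebra (F : Type) ℂ] (hι : (algebraMap (F : Type) ℂ).comp (cmConjRingHom (F : Type)) = ι₁) :
    ComponentAlbanese exists_isReal_hodgeModel_holds hodgePQ_independent_of_hodgeModel_holds
      (ballQuotientUniformisedDatum_of BallQuotient.ballQuotientUniformised_holds)
      (cmAbelianVarietyRealised_of_eigenbasis exists_isReal_hodgeModel_holds hodgePQ_independent_of_hodgeModel_holds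
        cmAbelianVarietyEigenbasisRealised_holds)
      Literature.NumberTheory.Transcendental.arapura2012_cor_15_4_6_holds V h Φ (ℭ⟦h, F, ι₁, V, Φ⟧) (𝒯⟦h, h6, F, ι₁, V, Φ⟧) :=
  componentAlbanesePinTotal exists_isReal_hodgeModel_holds hodgePQ_independent_of_hodgeModel_holds
    (ballQuotientUniformisedDatum_of BallQuotient.ballQuotientUniformised_holds)
    (cmAbelianVarietyRealised_of_eigenbasis exists_isReal_hodgeModel_holds hodgePQ_independent_of_hodgeModel_holds
      cmAbelianVarietyEigenbasisRealised_holds)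
    Literature.NumberTheory.Transcendental.arapura2012_cor_15_4_6_holds heckeTranslate_definedOver_holds V h
    (le_trans (by norm_num) h6) hι Φ isoOf

/-- **The level law of the J2 interface of record**: `(J.Γof K₁).K = K₁` (prove-3's ∕ wb-3's `hΓ` binder, token for token).
[cite: Liu2021, Prop. C.5 (FJcycle.tex l. 4627–4628)] -/
theorem socketJ_levelLaw (F : HodgeCM.CMField) [IsGalois ℚ (F : Type)] (h6 : 6 ≤ Module.finrank ℚ (F : Type))
    {ι₁ : (F : Type) →+* ℂ} (V : HodgeCM.HermSpace3 F ι₁) (h : exists_recordSystem) (Φ : CMType (F : Type))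
    [Algebra (F : Type) ℂ] (hι : (algebraMap (F : Type) ℂ).comp (cmConjRingHom (F : Type)) = ι₁)
    (K₁ : C5.SmallLevel (ℭ⟦h, F, ι₁, V, Φ⟧).S.K₀) :
    (((socketJ F h6 V h Φ hι).Γof K₁).K : Subgroup ↥V.adelicFin) = (K₁.1 : Subgroup (ℭ⟦h, F, ι₁, V, Φ⟧).G) :=
  componentAlbanesePinTotal_levelLaw exists_isReal_hodgeModel_holds hodgePQ_independent_of_hodgeModel_holds
    (ballQuotientUniformisedDatum_of BallQuotient.ballQuotientUniformised_holds)
    (cmAbelianVarietyRealised_of_eigenbasis exists_isReal_hodgeModel_holds hodgePQ_independent_of_hodgeModel_holds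
      cmAbelianVarietyEigenbasisRealised_holds)
    Literature.NumberTheory.Transcendental.arapura2012_cor_15_4_6_holds heckeTranslate_definedOver_holds V h
    (le_trans (by norm_num) h6) hι Φ isoOf K₁

/-- **The one object `D_μ ∈ 𝒜(μ)` of the ι₁-presented tail**, chosen once, from `h21` = [Shimura1998] Thm. 21.4 ([Liu2021] Prop. 4.6 (1)
over the carrier with all four bullets of Def. 4.5 (2) typed real, ✔ `Def45.nonempty_cmDatum_polDR_rMuForm_of_casselman`).
[cite: Liu2021, Def. 4.5 (2) (FJcycle.tex l. 1944–1951), Prop. 4.6 (1) (l. 1969)] [cite: Shimura1998, §21.4 Thm. 21.4] -/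
def socketDμ (F : HodgeCM.CMField) [IsGalois ℚ (F : Type)] (ι₁ : (F : Type) →+* ℂ) (h21 : shimura1998_thm21_4_casselman)
    (μ : Literature.NumberTheory.Automorphic.IdeleClassGroup (F : Type) →ₜ* Circle)
    (hμ : IdeleClassGroup.IsConjugateSymplectic (F : Type) μ) (hw : IdeleClassGroup.HasWeight (F : Type) μ 1) :
    ObjOne (AlgHom.id ℚ (F : Type)) ι₁ hμ hw (𝔠⟦ι₁, μ, hμ⟧) :=
  ⟨Def45.nonempty_cmDatum_polDR_rMuForm_of_casselman ι₁ hμ hw h21⟩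

/-- **A CM type has a member** (`τ' ∈ Φ_μ`, [Liu2021] proof of Thm. 4.18 l. 2250 «fix τ′ ∈ Φ_μ»): of an embedding and its conjugate
exactly one lies in `Φ`. [folklore] -/
theorem exists_mem_of_cmType {E : Type} [Field E] (Ψ : CMType E) (ι : E →+* ℂ) : ∃ τ : E →+* ℂ, τ ∈ Ψ.1 := by
  by_cases hι : ι ∈ Ψ.1
  · exact ⟨ι, hι⟩
  · refine ⟨NumberField.ComplexEmbedding.conjugate ι, (Ψ.2 _).2 ?_⟩
    have e : NumberField.ComplexEmbedding.conjugate (NumberField.ComplexEmbedding.conjugate ι) = ι :=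
      RingHom.ext fun x => by simp
    rw [e]
    exact hι


/-! ## §2  The (c) fields BY VALUE at the socket's literal types -/

set_option synthInstance.maxHeartbeats 400000 in
set_option maxHeartbeats 3200000 in
/-- **(c) `M` BY VALUE** — the rational (4.3) record of [Liu2021] (proof of Thm. 4.18, l. 2247–2253; Rem. 4.17) at the rest of record
`(𝕌 i).rest 𝔱⟦μ⟧` on the SHARED ι₁-presented tail: prove-2's `map43RecordAtPin` at the μ-uniform carriers of record, the J2 interface
`socketJ` under the instance `ῑ₁` (`hι` = ✔ `starRingEnd_comp_comp_cmConj`), the one object `socketDμ`, and any `τ' ∈ Φ_μ`.  The type is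
LITERALLY the socket's `M i μ hμ hw hΦμ` type (`U.rest (restTailOne …) = 𝒯.restOne …` by `rfl`, `UniformOmega.restOne_eq_rest`).
[cite: Liu2021, proof of Thm. 4.18 (FJcycle.tex l. 2247–2253); Rem. 4.17 (l. 2226–2228); Def. 4.16 (l. 2219)] -/
def socketM (F : HodgeCM.CMField) [IsGalois ℚ (F : Type)] (h6 : 6 ≤ Module.finrank ℚ (F : Type))
    {ι₁ : (F : Type) →+* ℂ} (V : HodgeCM.HermSpace3 F ι₁) (a₀ : RealScalar F) (h : exists_recordSystem) (Φ : CMType (F : Type))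
    (h21 : shimura1998_thm21_4_casselman) (i : 𝕀⟦V, ι₁, a₀⟧)
    (μ : Literature.NumberTheory.Automorphic.IdeleClassGroup (F : Type) →ₜ* Circle)
    (hμ : IdeleClassGroup.IsConjugateSymplectic (F : Type) μ) (hw : IdeleClassGroup.HasWeight (F : Type) μ 1) :
    (toThm418Data _ ((𝕌⟦h, F, ι₁, V, Φ, a₀, i⟧).rest 𝔱⟦h, h6, F, ι₁, V, Φ, μ, hμ, hw⟧)).Map43RationalData :=
  letI : Algebra (F : Type) ℂ := ((starRingEnd ℂ).comp ι₁).toAlgebra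
  (map43RecordAtPin (socketJ F h6 V h Φ (starRingEnd_comp_comp_cmConj ι₁)) (AlgHom.id ℚ (F : Type)) ι₁ hμ hw (𝔠⟦ι₁, μ, hμ⟧)
    (𝕌⟦h, F, ι₁, V, Φ, a₀, i⟧).Eps (𝕌⟦h, F, ι₁, V, Φ, a₀, i⟧).epsOf (𝕌⟦h, F, ι₁, V, Φ, a₀, i⟧).Chi
    ((𝕌⟦h, F, ι₁, V, Φ, a₀, i⟧).omega μ hμ) ((𝕌⟦h, F, ι₁, V, Φ, a₀, i⟧).rho μ hμ) (socketDμ F ι₁ h21 μ hμ hw)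
    (exists_mem_of_cmType hμ.cmType ι₁).choose (exists_mem_of_cmType hμ.cmType ι₁).choose_spec :)

set_option synthInstance.maxHeartbeats 400000 in
set_option maxHeartbeats 3200000 in
/-- **(c) `jH` BY VALUE** — the record's complex carrier `HB` IS the tower `= (𝔇).H` ([Liu2021] §4.2 l. 2076–2081; `LiuDictionary.ofTower`,
`rfl`), read by the identity: prove-2's `jHPin` (the spelling of prove-3's ∕ wb-3's `pieces` compositions). [cite: Liu2021, §4.2 (FJcycle.tex l. 2076–2081)] -/
def socketJH (F : HodgeCM.CMField) [IsGalois ℚ (F : Type)] (h6 : 6 ≤ Module.finrank ℚ (F : Type))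
    {ι₁ : (F : Type) →+* ℂ} (V : HodgeCM.HermSpace3 F ι₁) (a₀ : RealScalar F) (h : exists_recordSystem) (Φ : CMType (F : Type))
    (h21 : shimura1998_thm21_4_casselman) (i : 𝕀⟦V, ι₁, a₀⟧)
    (μ : Literature.NumberTheory.Automorphic.IdeleClassGroup (F : Type) →ₜ* Circle)
    (hμ : IdeleClassGroup.IsConjugateSymplectic (F : Type) μ) (hw : IdeleClassGroup.HasWeight (F : Type) μ 1) :
    (socketM F h6 V a₀ h Φ h21 i μ hμ hw).HB →ₗ[ℂ] (𝔇⟦V, ι₁, a₀⟧).H :=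
  letI : Algebra (F : Type) ℂ := ((starRingEnd ℂ).comp ι₁).toAlgebra
  jHPin (socketJ F h6 V h Φ (starRingEnd_comp_comp_cmConj ι₁)) (AlgHom.id ℚ (F : Type)) ι₁ hμ hw (𝔠⟦ι₁, μ, hμ⟧)
    (𝕌⟦h, F, ι₁, V, Φ, a₀, i⟧).Eps (𝕌⟦h, F, ι₁, V, Φ, a₀, i⟧).epsOf (𝕌⟦h, F, ι₁, V, Φ, a₀, i⟧).Chi
    ((𝕌⟦h, F, ι₁, V, Φ, a₀, i⟧).omega μ hμ) ((𝕌⟦h, F, ι₁, V, Φ, a₀, i⟧).rho μ hμ) (socketDμ F ι₁ h21 μ hμ hw)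
    (exists_mem_of_cmType hμ.cmType ι₁).choose (exists_mem_of_cmType hμ.cmType ι₁).choose_spec

/-- **(c) `hjHinj` BY VALUE**: `socketJH = id` is injective. [folklore] -/
theorem socketJH_injective (F : HodgeCM.CMField) [IsGalois ℚ (F : Type)] (h6 : 6 ≤ Module.finrank ℚ (F : Type))
    {ι₁ : (F : Type) →+* ℂ} (V : HodgeCM.HermSpace3 F ι₁) (a₀ : RealScalar F) (h : exists_recordSystem) (Φ : CMType (F : Type))
    (h21 : shimura1998_thm21_4_casselman) (i : 𝕀⟦V, ι₁, a₀⟧)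
    (μ : Literature.NumberTheory.Automorphic.IdeleClassGroup (F : Type) →ₜ* Circle)
    (hμ : IdeleClassGroup.IsConjugateSymplectic (F : Type) μ) (hw : IdeleClassGroup.HasWeight (F : Type) μ 1) :
    Function.Injective (socketJH F h6 V a₀ h Φ h21 i μ hμ hw) :=
  fun _ _ e => e

set_option synthInstance.maxHeartbeats 400000 in
set_option maxHeartbeats 3200000 in
/-- **(c) `hjH` BY VALUE**: `jH (ρB g x) = of g • jH x` — the record's `U(V)(𝔸_F^∞)`-action on `HB` is the tower's (J1 `towerRep_eq_of_smul`,
prove-2's `map43RecordAtPin_ρB_apply`). [cite: Liu2021, §4.2 (FJcycle.tex l. 2074–2081)] -/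
theorem socketJH_comm (F : HodgeCM.CMField) [IsGalois ℚ (F : Type)] (h6 : 6 ≤ Module.finrank ℚ (F : Type))
    {ι₁ : (F : Type) →+* ℂ} (V : HodgeCM.HermSpace3 F ι₁) (a₀ : RealScalar F) (h : exists_recordSystem) (Φ : CMType (F : Type))
    (h21 : shimura1998_thm21_4_casselman) (i : 𝕀⟦V, ι₁, a₀⟧)
    (μ : Literature.NumberTheory.Automorphic.IdeleClassGroup (F : Type) →ₜ* Circle)
    (hμ : IdeleClassGroup.IsConjugateSymplectic (F : Type) μ) (hw : IdeleClassGroup.HasWeight (F : Type) μ 1)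
    (g : ↥V.adelicFin) (x : (socketM F h6 V a₀ h Φ h21 i μ hμ hw).HB) :
    socketJH F h6 V a₀ h Φ h21 i μ hμ hw ((socketM F h6 V a₀ h Φ h21 i μ hμ hw).ρB g x) =
      MonoidAlgebra.of ℂ ↥V.adelicFin g • socketJH F h6 V a₀ h Φ h21 i μ hμ hw x :=
  letI : Algebra (F : Type) ℂ := ((starRingEnd ℂ).comp ι₁).toAlgebra
  jHPin_comm (socketJ F h6 V h Φ (starRingEnd_comp_comp_cmConj ι₁)) (AlgHom.id ℚ (F : Type)) ι₁ hμ hw (𝔠⟦ι₁, μ, hμ⟧)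
    (𝕌⟦h, F, ι₁, V, Φ, a₀, i⟧).Eps (𝕌⟦h, F, ι₁, V, Φ, a₀, i⟧).epsOf (𝕌⟦h, F, ι₁, V, Φ, a₀, i⟧).Chi
    ((𝕌⟦h, F, ι₁, V, Φ, a₀, i⟧).omega μ hμ) ((𝕌⟦h, F, ι₁, V, Φ, a₀, i⟧).rho μ hμ) (socketDμ F ι₁ h21 μ hμ hw)
    (exists_mem_of_cmType hμ.cmType ι₁).choose (exists_mem_of_cmType hμ.cmType ι₁).choose_spec g x


/-! ## §3  The four (c) families of the socket are jointly inhabited (the END's binder shape, key `hΦμ` carried and unused) -/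

set_option synthInstance.maxHeartbeats 400000 in
set_option maxHeartbeats 3200000 in
/-- **THE (c) HALF OF THE SOCKET IS INHABITED AT ITS LITERAL TYPES.**  In the binder shape of `SocketCD F h6 V a₀ h Φ` (END
`ClosedPrinted.lean` §A :161–:173: `∀ i μ hμ hw (hΦμ : HasCMType F μ (line i).lineType)`), the families `M ∕ jH` exist with `jH` injective
and `ℂ[U(V)(𝔸_F^∞)]`-equivariant — by `socketM ∕ socketJH` (the key `hΦμ` is not read: the (4.3) record exists for EVERY
conjugate-symplectic weight-one `μ`, [Liu2021] Rem. 4.17).  The fifth family `pieces` is NOT asserted (orientation-sensitive; see the module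
docstring).  One extra input beyond §A's: `h21` ([Shimura1998] Thm. 21.4, displayed by §B).  HC_CM is NOT proved.
[cite: Liu2021, proof of Thm. 4.18 (FJcycle.tex l. 2247–2253); Rem. 4.17 (l. 2226–2228); §4.2 (l. 2074–2081)] [cite: Shimura1998, §21.4 Thm. 21.4] -/
theorem exists_socketC (F : HodgeCM.CMField) [IsGalois ℚ (F : Type)] (h6 : 6 ≤ Module.finrank ℚ (F : Type))
    {ι₁ : (F : Type) →+* ℂ} (V : HodgeCM.HermSpace3 F ι₁) (a₀ : RealScalar F) (h : exists_recordSystem) (Φ : CMType (F : Type))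
    (h21 : shimura1998_thm21_4_casselman) :
    ∃ (M : ∀ (i : 𝕀⟦V, ι₁, a₀⟧) (μ : Literature.NumberTheory.Automorphic.IdeleClassGroup (F : Type) →ₜ* Circle)
        (hμ : IdeleClassGroup.IsConjugateSymplectic (F : Type) μ) (hw : IdeleClassGroup.HasWeight (F : Type) μ 1)
        (_ : IdeleClassGroup.HasCMType (F : Type) μ (𝕃⟦V, ι₁, a₀⟧ i).lineType),
        (toThm418Data _ ((𝕌⟦h, F, ι₁, V, Φ, a₀, i⟧).rest 𝔱⟦h, h6, F, ι₁, V, Φ, μ, hμ, hw⟧)).Map43RationalData)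
      (jH : ∀ (i : 𝕀⟦V, ι₁, a₀⟧) (μ : Literature.NumberTheory.Automorphic.IdeleClassGroup (F : Type) →ₜ* Circle)
        (hμ : IdeleClassGroup.IsConjugateSymplectic (F : Type) μ) (hw : IdeleClassGroup.HasWeight (F : Type) μ 1)
        (hΦμ : IdeleClassGroup.HasCMType (F : Type) μ (𝕃⟦V, ι₁, a₀⟧ i).lineType),
        (M i μ hμ hw hΦμ).HB →ₗ[ℂ] (𝔇⟦V, ι₁, a₀⟧).H),
      (∀ (i : 𝕀⟦V, ι₁, a₀⟧) (μ : Literature.NumberTheory.Automorphic.IdeleClassGroup (F : Type) →ₜ* Circle)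
          (hμ : IdeleClassGroup.IsConjugateSymplectic (F : Type) μ) (hw : IdeleClassGroup.HasWeight (F : Type) μ 1)
          (hΦμ : IdeleClassGroup.HasCMType (F : Type) μ (𝕃⟦V, ι₁, a₀⟧ i).lineType),
          Function.Injective (jH i μ hμ hw hΦμ)) ∧
      (∀ (i : 𝕀⟦V, ι₁, a₀⟧) (μ : Literature.NumberTheory.Automorphic.IdeleClassGroup (F : Type) →ₜ* Circle)
          (hμ : IdeleClassGroup.IsConjugateSymplectic (F : Type) μ) (hw : IdeleClassGroup.HasWeight (F : Type) μ 1)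
          (hΦμ : IdeleClassGroup.HasCMType (F : Type) μ (𝕃⟦V, ι₁, a₀⟧ i).lineType) (g : ↥V.adelicFin) (x : (M i μ hμ hw hΦμ).HB),
          jH i μ hμ hw hΦμ ((M i μ hμ hw hΦμ).ρB g x) = MonoidAlgebra.of ℂ ↥V.adelicFin g • jH i μ hμ hw hΦμ x) :=
  ⟨fun i μ hμ hw _ => socketM F h6 V a₀ h Φ h21 i μ hμ hw, fun i μ hμ hw _ => socketJH F h6 V a₀ h Φ h21 i μ hμ hw,
    fun i μ hμ hw _ => socketJH_injective F h6 V a₀ h Φ h21 i μ hμ hw,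
    fun i μ hμ hw _ g x => socketJH_comm F h6 V a₀ h Φ h21 i μ hμ hw g x⟩

end Summit.HodgeConjecture.CorCM.D2Bridge

end
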